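import Literature.RingTheory.FormalGroups.FormalOModuleLawOfBuds          -- ★ p844947: `exists_formalOModuleLaw_of_buds`, `coeff_single_zero/one_of_two_le_order`; brings ★ `IsOModuleBud`, defects, `DegreeCongruence`
import Literature.RingTheory.FormalGroups.FormalGroupStrictIsoTransport   -- ★ `coeff_single_powerSeries_subst` (linear coefficient of `φ(a)`)
import HarnessLib

/-!
# A formal `𝒪`-module law from a tower of box-compatible pre-buds: the tangent character

Topic `Literature/RingTheory/FormalGroups`; namespace `Literature.RingTheory.FormalGroups`.  Cell `hodgecm-mathlib`, P6 «MOD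
programme», sub-line `F0_P6d_ConnectedBTDictionary` stub `HLD` (the dictionary «connected `p`-divisible groups of dimension one
↔ formal `𝒪`-module laws», [Tate1967, §2.2], [Messing1972, Ch. II (3.3.18)]), σ1 step (P4).  THEOREMS ONLY (kernel lane), no
`def`, no instance, no notation, no `sorry`.

WHAT IS HERE.  The series extracted from the layers `G_n` of a connected BT group come as a TOWER: at level `n` a law `Pₙ` and
endomorphism series `ρₙ a` (`a ∈ 𝒪`) over a ring `B`, satisfying the axioms of a formal `𝒪`-module law MODULO TOTAL DEGREE
`Nₙ` (the box size of level `n`), EXCEPT that no `𝒪`-algebra structure on `B` is given in advance; consecutive levels agree on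
the box `{d : d₀, d₁ < Nₙ}`.  This file produces the `𝒪`-ALGEBRA STRUCTURE and the LIMIT LAW:

* §1 linear coefficients: `coeff_one_subst_pair_of_two_le_order` (`(G(f,g))₁ = f₁ + g₁` for `G ≡ X₀ + X₁ (mod deg 2)`),
  and the first-order consequences of the additivity ∕ multiplicativity ∕ unit defects having order `≥ 2`
  (`coeff_one_eq_add_of_addDefect`, `coeff_one_eq_mul_of_mulDefect`, `coeff_one_eq_one_of_two_le_order`,
  `coeff_one_eq_zero_of_two_le_order`);
* §2 **the tangent character** `exists_ringHom_apply_eq_coeff_one`: `a ↦ (ρ a)₁` is a ring homomorphism `χ : 𝒪 →+* B` as soon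
  as the add ∕ mul ∕ one defects have order `≥ 2` [Tate1967, §2.2 «the tangent space is an `𝒪`-module»];
* §3 **the tower theorem** `exists_formalOModuleLaw_of_tower`: for box sizes `N` with `2 ≤ N 1` and `2·Nₙ ≤ Nₙ₊₁`, a tower as
  above yields `χ` and, for the algebra structure `χ.toAlgebra`, a formal `𝒪`-module law `M` over `B` whose law and action
  AGREE WITH `Pₙ`, `ρₙ a` ON THE BOX OF EVERY LEVEL (proof: `χ` from level `1` by §2; levels `n+1` are `(Nₙ₊₁−1)`-buds
  (★ `IsOModuleBud`); box agreement ⇒ degree congruence, so ★ `exists_formalOModuleLaw_of_buds` gives the limit; degree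
  congruence at level `n+1` covers the box of level `n` since `2·Nₙ ≤ Nₙ₊₁`) [Lazard1955, §II; Tate1967, §2.2].

HC_CM is proved only modulo the printed citations until rung 0 closes; nothing here is about HC.
-/

namespace Literature.RingTheory.FormalGroups

open MvPowerSeries Finsupp

universe u v

variable {𝒪 : Type u} [CommRing 𝒪] {B : Type v} [CommRing B]

/-! ## §1 Linear coefficients -/

/-- **`(G(f,g))₁ = f₁ + g₁`** for a bivariate `G` with `G(0,0) = 0`, `G ≡ X₀ + X₁ (mod deg 2)` and univariate `f`, `g` without
constant term (the bud version of ★ `coeff_one_formalGroup_subst_pair`). [cite: Hazewinkel1978, §1.1 Def. (1.1.1)]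
[cite: Lazard1955, §II (bourgeons)] -/
theorem coeff_one_subst_pair_of_two_le_order {G : MvPowerSeries (Fin 2) B} (h0 : constantCoeff G = 0)
    (h2 : ((2 : ℕ) : ℕ∞) ≤ (G - X 0 - X 1).order) {f g : PowerSeries B}
    (hf : PowerSeries.constantCoeff f = 0) (hg : PowerSeries.constantCoeff g = 0) :
    PowerSeries.coeff 1 (G.subst ![(f : MvPowerSeries Unit B), g]) = PowerSeries.coeff 1 f + PowerSeries.coeff 1 g := by
  classical
  have hfg : HasSubst (![(f : MvPowerSeries Unit B), g]) :=
    hasSubst_of_constantCoeff_zero fun i => by fin_cases i; exacts [hf, hg]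
  have hX := coeff_single_zero_of_two_le_order h2
  have hY := coeff_single_one_of_two_le_order h2
  obtain ⟨f', rfl⟩ : PowerSeries.X ∣ f := (PowerSeries.X_dvd_iff).mpr hf
  obtain ⟨g', rfl⟩ : PowerSeries.X ∣ g := (PowerSeries.X_dvd_iff).mpr hg
  -- the term of the substitution formula at the exponent `d`
  have hterm : ∀ d : Fin 2 →₀ ℕ, d ≠ Finsupp.single 0 1 → d ≠ Finsupp.single 1 1 →
      coeff d G • PowerSeries.coeff 1 (d.prod fun s e => ((![PowerSeries.X * f', PowerSeries.X * g'] :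
          Fin 2 → PowerSeries B) s) ^ e) = 0 := by
    intro d hd0 hd1
    rw [Finsupp.prod_fintype _ _ (fun _ => pow_zero _)]
    simp only [Fin.prod_univ_two, Matrix.cons_val_zero, Matrix.cons_val_one]
    by_cases hd : d = 0
    · subst hd
      have : coeff (0 : Fin 2 →₀ ℕ) G = 0 := by simpa using h0
      rw [this, zero_smul]
    · -- `d 0 + d 1 ≥ 2`, so the product is divisible by `X ^ 2`
      have h2' : 2 ≤ d 0 + d 1 := by
        by_contra hlt
        have hle : d 0 + d 1 ≤ 1 := by omega
        rcases Nat.le_one_iff_eq_zero_or_eq_one.mp hle with h | h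
        · exact hd (by ext i; fin_cases i <;> simp_all)
        · rcases Nat.add_eq_one_iff.mp h with ⟨h0', h1'⟩ | ⟨h0', h1'⟩
          · exact hd1 (by ext i; fin_cases i <;> simp [h0', h1'])
          · exact hd0 (by ext i; fin_cases i <;> simp [h0', h1'])
      have : (PowerSeries.X * f') ^ (d 0) * (PowerSeries.X * g') ^ (d 1) =
          PowerSeries.X ^ (d 0 + d 1) * (f' ^ (d 0) * g' ^ (d 1)) := by ring
      rw [this, PowerSeries.coeff_X_pow_mul', if_neg (by omega), smul_zero]
  rw [PowerSeries.coeff, coeff_subst hfg, finsum_eq_sum_of_support_subset _ (s := {Finsupp.single 0 1, Finsupp.single 1 1}) ?_]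
  · rw [Finset.sum_pair (by simp [Finsupp.single_eq_single_iff])]
    simp only [Finsupp.prod_single_index, pow_zero, pow_one, Matrix.cons_val_zero, Matrix.cons_val_one, hX, hY, one_smul]
  · intro d hd
    simp only [Function.mem_support, ne_eq] at hd
    simp only [Finset.coe_insert, Finset.coe_singleton, Set.mem_insert_iff, Set.mem_singleton_iff]
    by_cases hd0 : d = Finsupp.single 0 1
    · exact Or.inl hd0
    by_cases hd1 : d = Finsupp.single 1 1
    · exact Or.inr hd1
    exact (hd (hterm d hd0 hd1)).elim

/-- **Additivity defect of order `≥ 2` ⇒ `χ₁ = φ₁ + ψ₁`** (`χ ≡ G(φ, ψ) (mod deg 2)`). [cite: Lazard1955, §II (bourgeons)]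
[cite: Hazewinkel1978, §21.1 Def. (21.1.1)] -/
theorem coeff_one_eq_add_of_addDefect {G : MvPowerSeries (Fin 2) B} (h0 : constantCoeff G = 0)
    (h2 : ((2 : ℕ) : ℕ∞) ≤ (G - X 0 - X 1).order) {φ ψ χ : PowerSeries B}
    (hφ : PowerSeries.constantCoeff φ = 0) (hψ : PowerSeries.constantCoeff ψ = 0)
    (h : ((2 : ℕ) : ℕ∞) ≤ MvPowerSeries.order (addDefect G φ ψ χ)) :
    PowerSeries.coeff 1 χ = PowerSeries.coeff 1 φ + PowerSeries.coeff 1 ψ := by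
  have h1 := (natCast_le_order_sub_iff.1 h) (Finsupp.single () 1) (by rw [Finsupp.degree_single]; omega)
  rw [← coeff_one_subst_pair_of_two_le_order h0 h2 hφ hψ]
  exact h1

/-- **Multiplicativity defect of order `≥ 2` ⇒ `χ₁ = φ₁ ψ₁`** (`χ ≡ φ(ψ) (mod deg 2)`). [cite: Lazard1955, §II (bourgeons)]
[cite: Hazewinkel1978, §21.1 Def. (21.1.1)] -/
theorem coeff_one_eq_mul_of_mulDefect {φ ψ χ : PowerSeries B} (hψ : PowerSeries.constantCoeff ψ = 0)
    (h : ((2 : ℕ) : ℕ∞) ≤ MvPowerSeries.order (mulDefect φ ψ χ)) :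
    PowerSeries.coeff 1 χ = PowerSeries.coeff 1 φ * PowerSeries.coeff 1 ψ := by
  have h1 := (natCast_le_order_sub_iff.1 h) (Finsupp.single () 1) (by rw [Finsupp.degree_single]; omega)
  have h2 := coeff_single_powerSeries_subst φ (a := (ψ : MvPowerSeries Unit B)) hψ ()
  rw [mulDefect] at h
  exact h1.trans h2

/-- **`ρ ≡ X (mod deg 2)` ⇒ `ρ₁ = 1`.** [cite: Lazard1955, §II (bourgeons)] -/
theorem coeff_one_eq_one_of_two_le_order {ρ : PowerSeries B}
    (h : ((2 : ℕ) : ℕ∞) ≤ MvPowerSeries.order (ρ - PowerSeries.X)) : PowerSeries.coeff 1 ρ = 1 := by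
  have h1 := (natCast_le_order_sub_iff.1 h) (Finsupp.single () 1) (by rw [Finsupp.degree_single]; omega)
  rw [← PowerSeries.coeff_one_X (R := B)]
  exact h1

/-- **`ρ ≡ 0 (mod deg 2)` ⇒ `ρ₁ = 0`.** [cite: Lazard1955, §II (bourgeons)] -/
theorem coeff_one_eq_zero_of_two_le_order {ρ : PowerSeries B} (h : ((2 : ℕ) : ℕ∞) ≤ MvPowerSeries.order ρ) :
    PowerSeries.coeff 1 ρ = 0 :=
  (natCast_le_order_iff.1 h) (Finsupp.single () 1) (by rw [Finsupp.degree_single]; omega)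

/-! ## §2 The tangent character -/

/-- **The tangent character.**  If the endomorphism series `ρ a` (`a ∈ 𝒪`, no constant terms) satisfy the additivity,
multiplicativity and unit axioms of a formal `𝒪`-module law MODULO DEGREE `2` w.r.t. a law `G ≡ X₀ + X₁ (mod deg 2)`, then
`a ↦ (ρ a)₁` is a ring homomorphism `χ : 𝒪 →+* B` — the action of `𝒪` on the tangent space. [cite: Tate1967, §2.2]
[cite: Hazewinkel1978, §21.1 Def. (21.1.1)] -/
theorem exists_ringHom_apply_eq_coeff_one {G : MvPowerSeries (Fin 2) B} (h0 : constantCoeff G = 0)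
    (h2 : ((2 : ℕ) : ℕ∞) ≤ (G - X 0 - X 1).order) {ρ : 𝒪 → PowerSeries B}
    (hρ0 : ∀ a, PowerSeries.constantCoeff (ρ a) = 0)
    (hadd : ∀ a b, ((2 : ℕ) : ℕ∞) ≤ MvPowerSeries.order (addDefect G (ρ a) (ρ b) (ρ (a + b))))
    (hmul : ∀ a b, ((2 : ℕ) : ℕ∞) ≤ MvPowerSeries.order (mulDefect (ρ a) (ρ b) (ρ (a * b))))
    (hone : ((2 : ℕ) : ℕ∞) ≤ MvPowerSeries.order (ρ 1 - PowerSeries.X)) :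
    ∃ χ : 𝒪 →+* B, ∀ a, χ a = PowerSeries.coeff 1 (ρ a) := by
  have hadd' : ∀ a b, PowerSeries.coeff 1 (ρ (a + b)) = PowerSeries.coeff 1 (ρ a) + PowerSeries.coeff 1 (ρ b) :=
    fun a b => coeff_one_eq_add_of_addDefect h0 h2 (hρ0 a) (hρ0 b) (hadd a b)
  have hzero : PowerSeries.coeff 1 (ρ 0) = 0 := by
    -- `x = x + x` forces `x = 0`
    have h := hadd' 0 0
    rw [add_zero] at h
    simpa using h
  let χ : 𝒪 →+* B :=
    { toFun := fun a => PowerSeries.coeff 1 (ρ a)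
      map_one' := coeff_one_eq_one_of_two_le_order hone
      map_mul' := fun a b => coeff_one_eq_mul_of_mulDefect (hρ0 b) (hmul a b)
      map_zero' := hzero
      map_add' := hadd' }
  exact ⟨χ, fun a => rfl⟩

/-! ## §3 The tower theorem -/

/-- Box vanishing implies degree congruence: if the coefficients of `H` in the box `{d : d₀ < N, d₁ < N}` vanish then
`H ≡ 0 (mod deg N)` (total degree `< N` forces both exponents `< N`). [cite: Lazard1955, §I Lemme 1] -/
private theorem natCast_le_order_of_box_vanishing {H : MvPowerSeries (Fin 2) B} {N : ℕ}
    (hH : ∀ d : Fin 2 →₀ ℕ, d 0 < N → d 1 < N → coeff d H = 0) : (N : ℕ∞) ≤ H.order := by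
  rw [natCast_le_order_iff]
  intro d hd
  have h0 : d 0 ≤ d.degree := Finsupp.le_degree 0 d
  have h1 : d 1 ≤ d.degree := Finsupp.le_degree 1 d
  exact hH d (by omega) (by omega)

/-- **THE TOWER THEOREM (tangent character + limit law).**  Let `N : ℕ → ℕ` be box sizes with `2 ≤ N 1` and
`2·N n ≤ N (n+1)`; at each level `n` let `P n` (bivariate) and `ρ n a` (`a ∈ 𝒪`, univariate) be series over `B` without
constant terms such that, whenever `2 ≤ N n`, `P n ≡ X₀ + X₁ (mod deg 2)`, and such that the associativity, commutativity,
homomorphism, additivity, multiplicativity, unit and zero defects all have order `≥ N n`; assume consecutive levels agree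
coefficientwise on the box `{d₀, d₁ < N n}` (resp. in degrees `< N n`).  Then `a ↦ (ρ₁ a)₁` is a ring homomorphism
`χ : 𝒪 →+* B` and, for the algebra structure `χ.toAlgebra`, there is a formal `𝒪`-module law `M` over `B` whose law agrees with
`P n` on the box of level `n` and whose action series `[a]_M` agrees with `ρ n a` in degrees `< N n`, for EVERY `n`.
[cite: Tate1967, §2.2] [cite: Lazard1955, §II (bourgeons)] [cite: Hazewinkel1978, §21.1 Def. (21.1.1)] -/
theorem exists_formalOModuleLaw_of_tower (N : ℕ → ℕ) (hN1 : 2 ≤ N 1) (hN : ∀ n, 2 * N n ≤ N (n + 1))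
    (P : ℕ → MvPowerSeries (Fin 2) B) (ρ : ℕ → 𝒪 → PowerSeries B)
    (hP0 : ∀ n, constantCoeff (P n) = 0) (hP2 : ∀ n, 2 ≤ N n → ((2 : ℕ) : ℕ∞) ≤ (P n - X 0 - X 1).order)
    (hρ0 : ∀ n a, PowerSeries.constantCoeff (ρ n a) = 0)
    (hassoc : ∀ n, (N n : ℕ∞) ≤ (assocDefect (P n)).order)
    (hcomm : ∀ n, (N n : ℕ∞) ≤ (commDefect (P n)).order)
    (hhom : ∀ n a, (N n : ℕ∞) ≤ (homDefect (P n) (ρ n a)).order)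
    (hadd : ∀ n a b, (N n : ℕ∞) ≤ MvPowerSeries.order (addDefect (P n) (ρ n a) (ρ n b) (ρ n (a + b))))
    (hmul : ∀ n a b, (N n : ℕ∞) ≤ MvPowerSeries.order (mulDefect (ρ n a) (ρ n b) (ρ n (a * b))))
    (hone : ∀ n, (N n : ℕ∞) ≤ MvPowerSeries.order (ρ n 1 - PowerSeries.X))
    (hzero : ∀ n, (N n : ℕ∞) ≤ MvPowerSeries.order (ρ n 0))
    (htP : ∀ n (d : Fin 2 →₀ ℕ), d 0 < N n → d 1 < N n → coeff d (P (n + 1)) = coeff d (P n))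
    (htρ : ∀ n a i, i < N n → PowerSeries.coeff i (ρ (n + 1) a) = PowerSeries.coeff i (ρ n a)) :
    ∃ χ : 𝒪 →+* B, (∀ a, χ a = PowerSeries.coeff 1 (ρ 1 a)) ∧
      letI := χ.toAlgebra
      ∃ M : FormalOModuleLaw 𝒪 B,
        (∀ n (d : Fin 2 →₀ ℕ), d 0 < N n → d 1 < N n → coeff d M.toFormalGroup.toPowerSeries = coeff d (P n)) ∧
        (∀ n a i, i < N n → PowerSeries.coeff i (M.act a).toPowerSeries = PowerSeries.coeff i (ρ n a)) := by
  -- numerics of the box sizes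
  have hmonoN : ∀ n, N n ≤ N (n + 1) := fun n => by have := hN n; omega
  have hN2 : ∀ n, 2 ≤ N (n + 1) := by
    intro n
    induction n with
    | zero => exact hN1
    | succ n ih => exact le_trans ih (hmonoN (n + 1))
  have hNge : ∀ n, n + 2 ≤ N (n + 1) := by
    intro n
    induction n with
    | zero => simpa using hN1
    | succ n ih => have := hN (n + 1); omega
  -- the tangent character, from level `1`
  have two_le : ∀ n, ((2 : ℕ) : ℕ∞) ≤ ((N (n + 1) : ℕ) : ℕ∞) := fun n => by exact_mod_cast hN2 n
  obtain ⟨χ, hχ⟩ := exists_ringHom_apply_eq_coeff_one (hP0 1) (hP2 1 hN1) (hρ0 1)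
    (fun a b => le_trans (two_le 0) (hadd 1 a b)) (fun a b => le_trans (two_le 0) (hmul 1 a b))
    (le_trans (two_le 0) (hone 1))
  refine ⟨χ, hχ, ?_⟩
  letI := χ.toAlgebra
  -- linear coefficients of `ρ (n+1) a` are all `χ a`
  have hlin : ∀ n a, PowerSeries.coeff 1 (ρ (n + 1) a) = χ a := by
    intro n a
    induction n with
    | zero => exact (hχ a).symm
    | succ n ih => rw [← ih]; exact htρ (n + 1) a 1 (lt_of_lt_of_le (by norm_num) (hN2 n))
  -- the levels `n+1` are `(N (n+1) - 1)`-buds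
  set m : ℕ → ℕ := fun n => N (n + 1) - 1 with hm
  have hm1 : ∀ n, m n + 1 = N (n + 1) := fun n => by simp only [hm]; have := hN2 n; omega
  have hbud : ∀ n, IsOModuleBud 𝒪 (m n) (P (n + 1)) (ρ (n + 1)) := fun n =>
    { constantCoeff_F := hP0 (n + 1)
      two_le_order_F := hP2 (n + 1) (hN2 n)
      constantCoeff_ρ := hρ0 (n + 1)
      coeff_one_ρ := fun a => by rw [hlin n a]; rfl
      assoc := by rw [hm1]; exact hassoc (n + 1)
      comm := by rw [hm1]; exact hcomm (n + 1)
      hom := fun a => by rw [hm1]; exact hhom (n + 1) a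
      add := fun a b => by rw [hm1]; exact hadd (n + 1) a b
      mul := fun a b => by rw [hm1]; exact hmul (n + 1) a b
      one := by rw [hm1]; exact hone (n + 1)
      zero := by rw [hm1]; exact hzero (n + 1) }
  -- hypotheses of ★ `exists_formalOModuleLaw_of_buds`
  have hmono : Monotone m := by
    refine monotone_nat_of_le_succ fun n => ?_
    simp only [hm]
    have := hmonoN (n + 1)
    omega
  have hmunb : ∀ k, ∃ n, k ≤ m n := fun k => ⟨k, by simp only [hm]; have := hNge k; omega⟩
  have hm1le : ∀ n, 1 ≤ m n := fun n => by simp only [hm]; have := hN2 n; omega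
  have hF : ∀ n, ((m n + 1 : ℕ) : ℕ∞) ≤ (P (n + 1 + 1) - P (n + 1)).order := fun n => by
    rw [hm1]
    refine natCast_le_order_of_box_vanishing fun d hd0 hd1 => ?_
    rw [map_sub, htP (n + 1) d hd0 hd1, sub_self]
  have hρ' : ∀ n a, ((m n + 1 : ℕ) : ℕ∞) ≤ MvPowerSeries.order (ρ (n + 1 + 1) a - ρ (n + 1) a) := fun n a => by
    rw [hm1]
    refine natCast_le_order_of_coeff_eq_zero fun i hi => ?_
    rw [map_sub, htρ (n + 1) a i hi, sub_self]
  obtain ⟨M, hMF, hMρ⟩ := exists_formalOModuleLaw_of_buds (𝒪 := 𝒪) hmono hmunb hm1le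
    (fun n => P (n + 1)) (fun n => ρ (n + 1)) hbud hF hρ'
  refine ⟨M, fun n d hd0 hd1 => ?_, fun n a i hi => ?_⟩
  · -- the box of level `n` lies below degree `N (n+1)`, where `M ≡ P (n+1)`, and `P (n+1)`, `P n` agree on that box
    have hdeg : d.degree < N (n + 1) := by
      have e : d.degree = d 0 + d 1 := by
        rw [Finsupp.degree_eq_sum, Fin.sum_univ_two]
      have := hN n
      omega
    have h := (natCast_le_order_sub_iff.1 ((hm1 n) ▸ hMF n)) d hdeg
    rw [h, htP n d hd0 hd1]
  · have hdeg : (Finsupp.single () i).degree < N (n + 1) := by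
      rw [Finsupp.degree_single]; exact lt_of_lt_of_le hi (hmonoN n)
    have h := (natCast_le_order_sub_iff.1 ((hm1 n) ▸ hMρ n a)) (Finsupp.single () i) hdeg
    rw [← htρ n a i hi]
    exact h

end Literature.RingTheory.FormalGroups
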